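import Summits.RiemannHypothesis.RiemannHypothesis.Theorems.DBNStripCorrector
import Summits.RiemannHypothesis.RiemannHypothesis.Theorems.DBNKernelMasses
import Mathlib.MeasureTheory.Function.JacobianOneDim
import Mathlib.Analysis.SpecialFunctions.Arsinh
import HarnessLib

/-!
# RiemannHypothesis / DBN — `StripKernelMass`: the strip kernel has total mass `1`

RH-FREE calculus (THEORY-R4 §2 of the `pub-dbn` cell, `Sketch4.lean` sha16 3a8b9a024097398f;
support-grade).  The typed statement `StripKernelMass` (byte-verbatim `DbnTheory4.StripKernelMass`) and
its proof: for `|η| < 1`, `∫_ℝ Q^{(η)}(x) dx = 1`, `Q^{(η)}(x) = ½ cos(πη/2) cosh(πx/2)/(cosh²(πx/2) − sin²(πη/2))`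
— substitute `u = sinh(πx/2)` (change of variables `integral_image_eq_integral_abs_deriv_smul`):
`cosh² − sin² = u² + cos²(πη/2)`, and `∫ c/(u²+c²) du = π` with `c = cos(πη/2) > 0`.

`--supports stmt-RiemannHypothesis-0274`; nothing here bears on the truth of RH.
-/

noncomputable section

-- D-0017: `Summit.<S>.<S>.…` is the designed namespace of a single-problem summit.
set_option linter.dupNamespace false

open scoped Real
open MeasureTheory Set

namespace Summit.RiemannHypothesis.RiemannHypothesis.Theorems.DbnTheory

/-- strip kernel: total mass `1`.  Verbatim `DbnTheory4.StripKernelMass`. -/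
def StripKernelMass : Prop := ∀ η : ℝ, |η| < 1 → ∫ x, stripKernel η x = 1

/-- **`StripKernelMass`** (THEORY-R4 §2): `∫ Q^{(η)} = 1` for `|η| < 1` (substitution `u = sinh(πx/2)`).
[folklore] -/
theorem StripKernelMass_holds : StripKernelMass := by
  intro η hη
  obtain ⟨hη1, hη2⟩ := abs_lt.mp hη
  have hc : 0 < Real.cos (π * η / 2) := by
    apply Real.cos_pos_of_mem_Ioo
    constructor <;> nlinarith [Real.pi_pos]
  set c := Real.cos (π * η / 2) with hc_def
  -- the substitution `u = sinh(πx/2)`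
  have hderiv : ∀ x ∈ (univ : Set ℝ),
      HasDerivWithinAt (fun x : ℝ => Real.sinh (π * x / 2)) (Real.cosh (π * x / 2) * (π / 2)) univ x := by
    intro x _
    have h1 : HasDerivAt (fun x : ℝ => π * x / 2) (π / 2) x := by
      have h := ((hasDerivAt_id' x).const_mul π).div_const 2
      simpa using h
    have h2 := (Real.hasDerivAt_sinh (π * x / 2)).comp x h1
    exact h2.hasDerivWithinAt
  have hinj : InjOn (fun x : ℝ => Real.sinh (π * x / 2)) univ := by
    intro x _ y _ hxy
    have h := Real.sinh_injective hxy
    have hπ := Real.pi_pos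
    nlinarith
  have himage : (fun x : ℝ => Real.sinh (π * x / 2)) '' univ = univ := by
    rw [image_univ, Set.eq_univ_iff_forall]
    intro y
    obtain ⟨t, ht⟩ := Real.sinh_surjective y
    refine ⟨2 * t / π, ?_⟩
    simp only
    rw [← ht]; congr 1; field_simp
  have key := integral_image_eq_integral_abs_deriv_smul MeasurableSet.univ hderiv hinj
    (fun u : ℝ => π⁻¹ * (c / (u ^ 2 + c ^ 2)))
  rw [himage, Measure.restrict_univ] at key
  -- left side of `key`: `∫ π⁻¹ c/(u²+c²) = 1`
  have hL : ∫ u : ℝ, π⁻¹ * (c / (u ^ 2 + c ^ 2)) = 1 := by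
    rw [MeasureTheory.integral_const_mul, integral_poisson hc, inv_mul_cancel₀ Real.pi_pos.ne']
  -- right side of `key` is `∫ Q^{(η)}`
  have hR : (fun x : ℝ => |Real.cosh (π * x / 2) * (π / 2)| • (π⁻¹ * (c / (Real.sinh (π * x / 2) ^ 2 + c ^ 2))))
      = fun x => stripKernel η x := by
    funext x
    have hcosh : 0 < Real.cosh (π * x / 2) := Real.cosh_pos _
    rw [abs_of_pos (by positivity), smul_eq_mul]
    unfold stripKernel
    have hden : Real.cosh (π * x / 2) ^ 2 - Real.sin (π * η / 2) ^ 2 = Real.sinh (π * x / 2) ^ 2 + c ^ 2 := by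
      have h1 := Real.cosh_sq (π * x / 2)
      have h2 := Real.sin_sq_add_cos_sq (π * η / 2)
      rw [hc_def]; nlinarith
    rw [hden, hc_def]
    have hπ : π ≠ 0 := Real.pi_pos.ne'
    field_simp
  rw [hR] at key
  rw [← key, hL]

end Summit.RiemannHypothesis.RiemannHypothesis.Theorems.DbnTheory

end
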